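import Mathlib.Topology.Algebra.Monoid
import Mathlib.Topology.Homeomorph.Defs
import Literature.IUT.LogThetaLattice.HolomorphicHull
import Literature.IUT.LogThetaLattice.PacketLogVolumes
import HarnessLib

/-!
# [IUTchIII] Remark 3.12.2 (v) and Remark 3.12.4 (iii): the kernels bound to the REAL hull and log-volume (c312 crew, wave 2, IV)

S. Mochizuki, *Inter-universal Teichmüller theory III*, author's kurims manuscript (May 2020) of PRIMS
**57** (2021), §3, Remark 3.12.2 (v), kurims p. 194 l. 24–36, and Remark 3.12.4 (iii), p. 196 l. 34–39
— READ ON THE PAGE (abc-iut-c312-8, 2026-08-25; `paper:url-4b091feeb646`). This file carries the parts of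
the typing of these two sub-items (see `Cor312Remarks2.lean` for the rest) that bind BY NAME to
abc-iut-L6-t4's landed definitions: the hull-sets and the **holomorphic hull** of [IUTchIII] Rmk 3.9.5 (i)
(`Literature.IUT.LogThetaLattice.IsHullSet` / `holomorphicHull`, `HolomorphicHull.lean` p404101) and the
**procession-normalization** of Prop. 3.9 (i) (`processionNormalized`, `PacketLogVolumes.lean` p404053).

* **Rmk 3.12.2 (v)** (CITED by Steps (xi-a), (xi-c), (xi-d) of the proof of Cor. 3.12; c312-2's
  `Cor312Proof.Locus.rem3_12_2_v`), p. 194 l. 30–36: "regions in log-shells may only be related to such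
  categories of arithmetic line bundles at the expense of allowing for an indeterminacy with respect to
  «`𝒪^×`»-multiples at each `v ∈ 𝕍`. It is precisely this indeterminacy that necessitates the introduction, in
  Step (xi) of the proof of Corollary 3.12, of holomorphic hulls, i.e., which have the effect of absorbing this
  indeterminacy [cf. the discussion of Remark 3.9.5, (vii), (viii), (ix), (x), for more details]." The
  elementary kernel, PROVED over the REAL objects: hull-sets `λ · 𝒪_{(−)} ⊆ 𝓘^ℚ((−)) ≅ ⊕_i k_i` are CARRIED ONTO
  THEMSELVES by every `𝒪^×`-multiple (`isHullSet_image_unitMul_eq`; the one-sided stability is L6-t4's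
  `IsHullSet.mul_mem` = Rmk 3.9.5 (vii) (Ob2)); the holomorphic hull of ANY region `U` already contains every
  `𝒪`-multiple of `U` (`image_mul_subset_holomorphicHull`); and — in the presence of the (product) topology of
  topological fields — the holomorphic hull of `u · U` EQUALS that of `U` for every `𝒪^×`-multiple
  (`holomorphicHull_image_unitMul`): replacing a region by any of its `𝒪^×`-multiples is invisible after
  passing to the hull. Nothing here says which regions arise in Cor. 3.12 or what their log-volumes are.
* **Rmk 3.12.4 (iii)** p. 196 l. 34–39: "one may think of the procession-normalized volumes obtained by
  taking averages over `j ∈ 𝔽_l^⋇` [cf. Corollary 3.12] as corresponding to the operation of dividing by `p` …"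
  — the noun bound to the real definition: `processionNormalized_eq_average` (`rfl`); the Witt-vector
  analogy itself is row `Fig310Row.thetaValueLabels` of `Cor312Remarks2.lean`, quoted only.
Record-only typing of a DISPUTED text (claim key `Mochizuki2012`); nothing here takes a side on Cor. 3.12.
-/

namespace Summit.ABC.IUTFork.Cor312Rmk

open Literature.IUT.LogThetaLattice

universe u v

section Hull

variable {ι : Type u} {k : ι → Type v} [∀ i, Field (k i)] (O : ∀ i, Subring (k i))

/-- An `𝒪^×`-multiple: a family of units `u_i ∈ 𝒪^×_{k_i}` of the integral structures, as an element of
`𝓘^ℚ((−)) ≅ ⊕_i k_i = Π_i k_i` (Rmk 3.12.2 (v), p. 194 l. 32: "an indeterminacy with respect to «`𝒪^×`»-multiples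
at each `v ∈ 𝕍`"). [cite: Mochizuki2012, III Rmk 3.12.2 (v) p.194] -/
def unitVal (u : ∀ i, (O i)ˣ) : ∀ i, k i := fun i => ((u i : O i) : k i)

/-- The components of an `𝒪^×`-multiple are integral. [cite: Mochizuki2012, III Rmk 3.12.2 (v) p.194] -/
theorem unitVal_mem (u : ∀ i, (O i)ˣ) (i : ι) : unitVal O u i ∈ O i := (u i : O i).2

/-- `u⁻¹ · u = 1` componentwise for an `𝒪^×`-multiple. [cite: Mochizuki2012, III Rmk 3.12.2 (v) p.194] -/
theorem unitVal_inv_mul (u : ∀ i, (O i)ˣ) : unitVal O (fun i => (u i)⁻¹) * unitVal O u = 1 := by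
  funext i
  show (((u i)⁻¹ : (O i)ˣ) : O i).1 * ((u i : O i)).1 = 1
  rw [← Subring.coe_mul, Units.inv_mul, Subring.coe_one]

/-- `u · u⁻¹ = 1` componentwise for an `𝒪^×`-multiple. [cite: Mochizuki2012, III Rmk 3.12.2 (v) p.194] -/
theorem unitVal_mul_inv (u : ∀ i, (O i)ˣ) : unitVal O u * unitVal O (fun i => (u i)⁻¹) = 1 := by
  rw [mul_comm]; exact unitVal_inv_mul O u

/-- **Rmk 3.12.2 (v)** kernel, first form (p. 194 l. 33–36, "holomorphic hulls … have the effect of absorbing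
this indeterminacy"): a hull-set `H = λ · 𝒪_{(−)}` ([IUTchIII] Rmk 3.9.5 (i); L6-t4's `IsHullSet`) is carried
ONTO ITSELF by multiplication by any `𝒪^×`-multiple `u`: `u · H = H`. PROVED from L6-t4's (Ob2) lemma
`IsHullSet.mul_mem` applied to `u` and to `u⁻¹`. [cite: Mochizuki2012, III Rmk 3.12.2 (v) p.194] -/
theorem isHullSet_image_unitMul_eq {H : Set (∀ i, k i)} (hH : IsHullSet O H) (u : ∀ i, (O i)ˣ) :
    (fun x => unitVal O u * x) '' H = H := by
  apply Set.Subset.antisymm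
  · rintro _ ⟨x, hx, rfl⟩
    exact hH.mul_mem O (unitVal_mem O u) hx
  · intro x hx
    refine ⟨unitVal O (fun i => (u i)⁻¹) * x, hH.mul_mem O (unitVal_mem O _) hx, ?_⟩
    show unitVal O u * (unitVal O (fun i => (u i)⁻¹) * x) = x
    rw [← mul_assoc, unitVal_mul_inv, one_mul]

/-- **Rmk 3.12.2 (v)** kernel, second form: for ANY region `U ⊆ 𝓘^ℚ((−))` and any integral multiple `a ∈ Π_i 𝒪_{k_i}`
(in particular any `𝒪^×`-multiple), `a · U` is already contained in the holomorphic hull of `U` (L6-t4's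
`holomorphicHull` = the intersection of all hull-sets containing `U` if `U` is relatively compact, else
everything): the hull does not see WHICH `𝒪^×`-multiple of a region one started from. PROVED.
[cite: Mochizuki2012, III Rmk 3.12.2 (v) p.194] -/
theorem image_mul_subset_holomorphicHull [∀ i, TopologicalSpace (k i)] (U : Set (∀ i, k i))
    {a : ∀ i, k i} (ha : ∀ i, a i ∈ O i) : (fun x => a * x) '' U ⊆ holomorphicHull O U := by
  rintro _ ⟨x, hx, rfl⟩
  unfold holomorphicHull
  split_ifs
  · exact Set.mem_sInter.mpr fun H hH => hH.1.mul_mem O ha (hH.2 hx)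
  · exact Set.mem_univ _

variable [∀ i, TopologicalSpace (k i)] [∀ i, ContinuousMul (k i)]

/-- Multiplication by an `𝒪^×`-multiple is a homeomorphism of `𝓘^ℚ((−)) = Π_i k_i` (product topology of the
topological fields `k_i`); used to transport "relatively compact" in `holomorphicHull_image_unitMul`.
[folklore] -/
def unitMulHomeomorph (u : ∀ i, (O i)ˣ) : (∀ i, k i) ≃ₜ (∀ i, k i) where
  toFun x := unitVal O u * x
  invFun x := unitVal O (fun i => (u i)⁻¹) * x
  left_inv x := by
    show unitVal O (fun i => (u i)⁻¹) * (unitVal O u * x) = x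
    rw [← mul_assoc, unitVal_inv_mul, one_mul]
  right_inv x := by
    show unitVal O u * (unitVal O (fun i => (u i)⁻¹) * x) = x
    rw [← mul_assoc, unitVal_mul_inv, one_mul]
  continuous_toFun := continuous_const.mul continuous_id
  continuous_invFun := continuous_const.mul continuous_id

/-- Relative compactness is invariant under an `𝒪^×`-multiple (a homeomorphism). [folklore] -/
theorem isCompact_closure_image_unitMul_iff (u : ∀ i, (O i)ˣ) (U : Set (∀ i, k i)) :
    IsCompact (closure ((fun x => unitVal O u * x) '' U)) ↔ IsCompact (closure U) := by
  have h : (fun x => unitVal O u * x) '' U = (unitMulHomeomorph O u) '' U := rfl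
  rw [h, ← Homeomorph.image_closure, Homeomorph.isCompact_image]

/-- **Rmk 3.12.2 (v)** kernel, third form (p. 194 l. 30–36): the holomorphic hull ABSORBS the `𝒪^×`-multiple
indeterminacy — for every region `U` and every `𝒪^×`-multiple `u`, `hull(u · U) = hull(U)`. PROVED: both hulls
are the intersection of the SAME family of hull-sets (a hull-set contains `U` iff it contains `u · U`, by
`isHullSet_image_unitMul_eq`), and `U` is relatively compact iff `u · U` is. This is the precise sense, at the
level of L6-t4's definitions, in which replacing the region attached to an arithmetic line bundle by an
`𝒪^×`-multiple is invisible after passing to the holomorphic hull. [cite: Mochizuki2012, III Rmk 3.12.2 (v) p.194] -/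
theorem holomorphicHull_image_unitMul (u : ∀ i, (O i)ˣ) (U : Set (∀ i, k i)) :
    holomorphicHull O ((fun x => unitVal O u * x) '' U) = holomorphicHull O U := by
  have key : ∀ H, IsHullSet O H → ((fun x => unitVal O u * x) '' U ⊆ H ↔ U ⊆ H) := by
    intro H hH
    constructor
    · intro h x hx
      have hux : unitVal O u * x ∈ H := h ⟨x, hx, rfl⟩
      have := hH.mul_mem O (unitVal_mem O fun i => (u i)⁻¹) hux
      rwa [← mul_assoc, unitVal_inv_mul, one_mul] at this
    · intro h
      rw [← isHullSet_image_unitMul_eq O hH u]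
      exact Set.image_mono h
  unfold holomorphicHull
  rw [isCompact_closure_image_unitMul_iff O u U]
  split_ifs
  · congr 1
    ext H
    simp only [Set.mem_setOf_eq]
    constructor
    · rintro ⟨hH, hsub⟩; exact ⟨hH, (key H hH).mp hsub⟩
    · rintro ⟨hH, hsub⟩; exact ⟨hH, (key H hH).mpr hsub⟩
  · rfl

end Hull

/-! ## Remark 3.12.4 (iii): "procession-normalized volumes obtained by taking averages over `j ∈ 𝔽_l^⋇`" -/

/-- **IUTchIII:Rmk3.12.4(iii)** (kurims p. 196 l. 34–39): "one may think of the procession-normalized volumes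
obtained by taking averages over `j ∈ 𝔽_l^⋇` [cf. Corollary 3.12] as corresponding to the operation of dividing
by `p` to relate the «mod `p/p²` portion» of the Witt vectors to the «mod `p` portion» of the Witt vectors" —
the noun "procession-normalized volume … average over `j ∈ 𝔽_l^⋇`" is abc-iut-L6-t4's `processionNormalized`
([IUTchIII] Prop. 3.9 (i), `PacketLogVolumes.lean`): the average of the `l⋇` capsule volumes. PROVED (`rfl`);
the Witt-vector analogy is quoted only (row `Fig310Row.thetaValueLabels` of `Cor312Remarks2.lean`).
[cite: Mochizuki2012, III Rmk 3.12.4 (iii) p.196] -/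
theorem processionNormalized_eq_average {lstar : ℕ} (vol : Fin lstar → ℝ) :
    processionNormalized vol = (∑ j, vol j) / lstar := rfl

end Summit.ABC.IUTFork.Cor312Rmk
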